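import Summits.QuantumFields.YangMills.Theorems.SourcedPressureJensenSourcedPressureDecouplingStubSeamFE
import HarnessLib

/-!
# KS2″ `SourcedPressureDecoupling` (stmt-QuantumFields-24296), line «exact-seam», stub `stub_crudeFE`:
# the free energy per site of a mesoscopic free cube is Lipschitz in `log β` to Gaussian precision

For every compact simple `G`, lattice representation `r` and `0 < θ ≤ 1/64` there are `C₁ (= 3D)`, `C₂ (= 1)`, `κ₃ > 0`, `β₀` with

  `F(B_s, β(1−u)) − F(B_s, β) ≤ C₁·u + C₂·β^(−κ₃)`   for `β ≥ β₀`, `β^θ ≤ s ≤ 4β^θ`, `0 ≤ u ≤ 1/2`,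

`F(B_s, ·)` = Sweep1's `freeEnergyPerSite` of the free-boundary cube with `s` sites per axis.  In the line this prices the slack of the
Hölder coefficient (`cellCount/(2·intCard) − 1/2 ≤ 4n/s`) against the crude bound `freeCell(t) ≤ F(B_s, β(1−2tW)) − F(B_s, β)`
(`stub_crudeId`).  Proof: the windowed one-box upper bound `T_le_window` (sibling file `…StubSeamFE`) at the second coupling
`β' = β(1−u) ∈ [β/2, β]`, the Lemma-17.3 lower bound `F(B_s, β) ≥ ((s+1)/s)⁴ f(β)` (`ChatterjeeFreeEnergy.freeEnergyDensity_le`) with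
the torus lower rate `freeEnergyDensity_lower`, and `−(3D/2) log(1−u) ≤ 3Du`.

Helper for the CLOSED (superseded) route `SourcedPressureJensen` — an instrument statement; RECORD-label rung R2xi-G was closed by
`ColdBoxAllGroups`; the Yang–Mills mass gap is NOT proved by anything here.
-/

noncomputable section

open scoped Matrix.Norms.Frobenius ENNReal NNReal
open MeasureTheory Measure Filter Topology Set
open Literature.Probability.LatticeModels Literature.MathematicalPhysics.QuantumLattice
open Literature.MathematicalPhysics.QuantumFieldTheory
open Summit.QuantumFields.YangMills.Theorems.FreeEnergyLogCoefficient
open Summit.QuantumFields.YangMills.Theorems.FreeEnergyRate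
open ChatterjeeJointLimit WilsonWeakCoupling LatticeMaxwell ChatterjeeAssembly AxialGauge

namespace Summit.QuantumFields.YangMills.Cruxes.SourcedPressureDecoupling.EntropicSeam

/-! ### Stub `stub_crudeFE`: the two-coupling free-energy difference in the window -/

/-- `log β − log(β(1 − u)) ≤ 2u` for `β > 0`, `0 ≤ u ≤ 1/2` (`−log(1−u) ≤ u/(1−u) ≤ 2u`). [folklore] -/
theorem log_sub_log_mul_one_sub_le {β u : ℝ} (hβ : 0 < β) (h0 : 0 ≤ u) (h1 : u ≤ 1 / 2) :
    Real.log β - Real.log (β * (1 - u)) ≤ 2 * u := by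
  have hpos : 0 < 1 - u := by linarith
  rw [Real.log_mul hβ.ne' hpos.ne']
  have h := Real.one_sub_inv_le_log_of_pos hpos
  have hinv : (1 - u)⁻¹ ≤ 1 + 2 * u := by
    rw [inv_eq_one_div, div_le_iff₀ hpos]
    nlinarith
  linarith

set_option linter.style.nameCheck false in
/-- Registered statement of `stub_crudeFE` (name-keyed alias of the skeleton `Cruxes/SourcedPressureDecoupling/Lines/exact_seam.lean`,
restated verbatim: `Cruxes/` is not importable). -/
abbrev __Registered.stub_crudeFE : Prop :=
  ∀ (G : Type) [Group G] [TopologicalSpace G] [IsTopologicalGroup G] [CompactSpace G], IsCompactSimpleLieGroup G → letI : MeasurableSpace G := borel G; haveI : BorelSpace G := ⟨rfl⟩; ∀ r : LatticeRep G, ∀ θ : ℝ, 0 < θ → θ ≤ 1 / 64 → ∃ C₁ C₂ κ₃ β₀ : ℝ, 0 < κ₃ ∧ ∀ β : ℝ, β₀ ≤ β → ∀ ℓ : ℕ, β ^ θ ≤ (ℓ + 1 : ℝ) → (ℓ + 1 : ℝ) ≤ 4 * β ^ θ → ∀ u : ℝ, 0 ≤ u → u ≤ 1 / 2 →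
    freeEnergyPerSite r.ρ (β * (1 - u)) (halfOpenBox 4 (ℓ + 1)) - freeEnergyPerSite r.ρ β (halfOpenBox 4 (ℓ + 1)) ≤ C₁ * u + C₂ * β ^ (-κ₃)

/-- Lemma 17.3 in per-site form: from `f ≤ log Z/(s+1)⁴`, `X ≤ f` and `F = log Z/s⁴` (`s ≥ 1`),
`X − (15/s)|X| ≤ F` (`((s+1)/s)⁴ ≤ 1 + 15/s`). [cite: arXiv160201222, Lemma 17.3] -/
theorem lower_aux {F lZ f X s : ℝ} (hs : 1 ≤ s) (hF : F = lZ / s ^ 4) (hfle : f ≤ lZ / (s + 1) ^ 4)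
    (hfX : X ≤ f) : X - 15 * (1 / s) * |X| ≤ F := by
  have hs0 : 0 < s := by linarith
  have hs2 : (0 : ℝ) < (s + 1) ^ 4 := by positivity
  have hlZge : (s + 1) ^ 4 * X ≤ lZ := by
    have h1 : f * (s + 1) ^ 4 ≤ lZ := by rwa [le_div_iff₀ hs2] at hfle
    have h2 : (s + 1) ^ 4 * X ≤ (s + 1) ^ 4 * f := mul_le_mul_of_nonneg_left hfX hs2.le
    linarith [mul_comm f ((s + 1) ^ 4)]
  have hinv0 : 0 ≤ 1 / s := by positivity
  have hF0ge : (1 + 1 / s) ^ 4 * X ≤ F := by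
    rw [hF]
    have e : (1 + 1 / s) ^ 4 * X = ((s + 1) ^ 4 * X) / s ^ 4 := by
      field_simp
    rw [e]
    exact div_le_div_of_nonneg_right hlZge (by positivity)
  have hy : (1 + 1 / s) ^ 4 ≤ 1 + 15 * (1 / s) := by
    -- `(1 + x)⁴ ≤ 1 + 15x` on `[0, 1]`
    have h1 : 1 / s ≤ 1 := by rw [div_le_one hs0]; exact hs
    have hx2 : (1 / s) ^ 2 ≤ 1 / s := by nlinarith
    have hx3 : (1 / s) ^ 3 ≤ 1 / s := by nlinarith
    have hx4 : (1 / s) ^ 4 ≤ 1 / s := by nlinarith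
    nlinarith
  have hy1 : 0 ≤ (1 + 1 / s) ^ 4 - 1 := by
    have : (1 : ℝ) ≤ (1 + 1 / s) ^ 4 := one_le_pow₀ (by linarith)
    linarith
  have h2 := mul_le_mul_of_nonneg_left (neg_abs_le X) hy1
  have h3 : ((1 + 1 / s) ^ 4 - 1) * |X| ≤ 15 * (1 / s) * |X| :=
    mul_le_mul_of_nonneg_right (by linarith) (abs_nonneg X)
  have e2 : (1 + 1 / s) ^ 4 * X = X + ((1 + 1 / s) ^ 4 - 1) * X := by ring
  have e3 : ((1 + 1 / s) ^ 4 - 1) * -|X| = -(((1 + 1 / s) ^ 4 - 1) * |X|) := by ring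
  linarith [hF0ge, h2, h3, e2, e3]

/-- The window at the second coupling: for `β/2 ≤ β' ≤ β`, `0 < θ ≤ 1`, `8 ≤ β'^{a−θ}` and `β^θ ≤ s ≤ 4β^θ`,
`β'^θ ≤ 2s` and `s ≤ β'^a`. [folklore] -/
theorem window_aux {β β' θ a s : ℝ} (hβ0 : 0 < β) (hβ'0 : 0 < β') (hlo : β / 2 ≤ β') (hhi : β' ≤ β)
    (hθ : 0 < θ) (hθ1 : θ ≤ 1) (h8 : 8 ≤ β' ^ (a - θ)) (hs1 : β ^ θ ≤ s) (hs2 : s ≤ 4 * β ^ θ) :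
    β' ^ θ ≤ 2 * s ∧ s ≤ β' ^ a := by
  have hβθ : 0 < β ^ θ := Real.rpow_pos_of_pos hβ0 θ
  have hβ'θ : 0 < β' ^ θ := Real.rpow_pos_of_pos hβ'0 θ
  have hθ' : β' ^ θ ≤ β ^ θ := Real.rpow_le_rpow hβ'0.le hhi hθ.le
  have h2θ : β ^ θ ≤ 2 * β' ^ θ := by
    have e : (2 * β') ^ θ = 2 ^ θ * β' ^ θ := Real.mul_rpow (by norm_num) hβ'0.le
    have h2 : (2 : ℝ) ^ θ ≤ 2 := by
      have := Real.rpow_le_rpow_of_exponent_le (by norm_num : (1 : ℝ) ≤ 2) hθ1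
      rwa [Real.rpow_one] at this
    calc β ^ θ ≤ (2 * β') ^ θ := Real.rpow_le_rpow hβ0.le (by linarith) hθ.le
      _ = 2 ^ θ * β' ^ θ := e
      _ ≤ 2 * β' ^ θ := mul_le_mul_of_nonneg_right h2 hβ'θ.le
  have hwin : β' ^ θ * β' ^ (a - θ) = β' ^ a := by
    rw [← Real.rpow_add hβ'0]; congr 1; ring
  refine ⟨by linarith, ?_⟩
  have := mul_le_mul_of_nonneg_left h8 hβ'θ.le
  linarith [hwin]

/-- The real-arithmetic core of `stub_crudeFE` (all analytic objects opaque). -/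
theorem crude_arith {F' F0 A₀ eU' eU e₂ eκ Dl Dl' q x X absX c₀ u D Eβ : ℝ}
    (hF'le : F' ≤ A₀ + eU' - 3 / 2 * Dl' + 2 * q * Dl') (hFlo : X - 15 * q * absX ≤ F0)
    (hX : X = A₀ - e₂ - 3 / 2 * Dl) (hXabs : absX ≤ |A₀| + 1 + 3 / 2 * Dl) (habs0 : 0 ≤ absX)
    (hDdiff : Dl - Dl' ≤ D * (2 * u)) (hDl'le : Dl' ≤ Dl) (hDl0 : 0 ≤ Dl)
    (hq0 : 0 ≤ q) (hqx : q ≤ x) (hx0 : 0 ≤ x) (hU' : eU' ≤ c₀ * eU)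
    (hEβ : Eβ = c₀ * eU + e₂ + 49 / 2 * (x * Dl) + (15 * |A₀| + 15) * x) (hEle : Eβ ≤ eκ) :
    F' - F0 ≤ 3 * D * u + eκ := by
  have p1 : q * Dl' ≤ q * Dl := mul_le_mul_of_nonneg_left hDl'le hq0
  have p2 : q * Dl ≤ x * Dl := mul_le_mul_of_nonneg_right hqx hDl0
  have p3 : q * absX ≤ x * absX := mul_le_mul_of_nonneg_right hqx habs0
  have p4 : x * absX ≤ x * (|A₀| + 1 + 3 / 2 * Dl) := mul_le_mul_of_nonneg_left hXabs hx0
  nlinarith [p1, p2, p3, p4, hF'le, hFlo, hX, hDdiff, hU', hEβ, hEle, abs_nonneg A₀]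

/-- **Stub `stub_crudeFE` of line «exact-seam»** (the free energy per site of a mesoscopic free cube is Lipschitz in `log β` to
Gaussian precision): for every compact simple `G`, lattice representation `r` and `0 < θ ≤ 1/64` there are `C₁ = 3D`, `C₂ = 1`,
`κ₃ > 0`, `β₀` with `F(B_s, β(1−u)) − F(B_s, β) ≤ C₁ u + C₂ β^(−κ₃)` for `β ≥ β₀`, `β^θ ≤ s ≤ 4β^θ`, `0 ≤ u ≤ 1/2`.  Upper bound at
`β' = β(1−u) ≥ β/2` by `T_le_window`; lower bound `F(B_s, β) ≥ ((s+1)/s)⁴ f(β)` (Lemma 17.3, `ChatterjeeFreeEnergy.freeEnergyDensity_le`)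
with the torus lower rate `freeEnergyDensity_lower`; `(3D/2) log(β/β') = −(3D/2) log(1−u) ≤ 3Du`. [cite: arXiv160201222, Lemmas 17.2, 17.3, §17] -/
theorem stub_crudeFE : __Registered.stub_crudeFE := by
  intro G _ _ _ _ hG
  letI : MeasurableSpace G := borel G
  haveI : BorelSpace G := ⟨rfl⟩
  intro r θ hθ hθ64
  haveI : SecondCountableTopology (Matrix (Fin r.N) (Fin r.N) ℂ) :=
    inferInstanceAs (SecondCountableTopology (Fin r.N → Fin r.N → ℂ))
  haveI : SecondCountableTopology G :=
    (r.continuous.isClosedEmbedding r.injective).isEmbedding.secondCountableTopology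
  obtain ⟨B, hBlog, -⟩ :=
    exists_oneBoxBounds (d := 4) r.ρ (by norm_num) r.continuous r.injective r.mem_unitary
  obtain ⟨L, hL⟩ := LatticeMaxwell.tendsto_logZM_div (d := 4) (by norm_num)
  obtain ⟨CM, hCM⟩ := stub_maxwellRate (d := 4) (by norm_num) hL
  obtain ⟨κU, hκU, hU⟩ := T_le_window (d := 4) (by norm_num) B hCM hθ
  obtain ⟨κ₂, hκ₂, hLow⟩ := stub_lowerRate (d := 4) (by norm_num) B hCM
  have hLow' := freeEnergyDensity_lower r B hBlog hLow
  have hD : (0 : ℝ) ≤ (B.D : ℝ) := Nat.cast_nonneg _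
  have hρN := re_trace_le_of_unitary r.ρ r.mem_unitary
  set A₀ : ℝ := (((4 : ℕ) : ℝ) - 1) * Real.log B.cH + (B.D : ℝ) * L with hA₀
  -- the rate `κ₃` and the absorption of the error terms
  obtain ⟨κ₃, hκ₃0, hk1, hk2, hk3⟩ : ∃ κ₃ : ℝ, 0 < κ₃ ∧ κ₃ < κU ∧ κ₃ < κ₂ ∧ κ₃ < θ := by
    refine ⟨min (min κU κ₂) θ / 2, ?_, ?_, ?_, ?_⟩
    · have : 0 < min (min κU κ₂) θ := lt_min (lt_min hκU hκ₂) hθ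
      positivity
    · have : min (min κU κ₂) θ ≤ κU := (min_le_left _ _).trans (min_le_left _ _)
      linarith
    · have : min (min κU κ₂) θ ≤ κ₂ := (min_le_left _ _).trans (min_le_right _ _)
      linarith
    · have : min (min κU κ₂) θ ≤ θ := min_le_right _ _
      linarith
  set c₀ : ℝ := (1 / 2 : ℝ) ^ (-κU) with hc₀
  have hc₀0 : 0 < c₀ := Real.rpow_pos_of_pos (by norm_num) _
  set E : ℝ → ℝ := fun β => c₀ * β ^ (-κU) + β ^ (-κ₂) + 49 / 2 * (β ^ (-θ) * ((B.D : ℝ) * Real.log β)) +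
    (15 * |A₀| + 15) * β ^ (-θ) with hE
  have hEt : Tendsto (fun β => β ^ κ₃ * E β) atTop (𝓝 0) := by
    have t1 := (tendsto_rpow_mul_rpow (κ := κ₃) (p := -κU) (by linarith)).const_mul c₀
    have t2 := tendsto_rpow_mul_rpow (κ := κ₃) (p := -κ₂) (by linarith)
    have t3 := (tendsto_rpow_mul_rpow_mul_log (κ := κ₃) (p := -θ) (by linarith)).const_mul
      (49 / 2 * (B.D : ℝ))
    have t4 := (tendsto_rpow_mul_rpow (κ := κ₃) (p := -θ) (by linarith)).const_mul (15 * |A₀| + 15)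
    have hsum := ((t1.add t2).add t3).add t4
    simp only [mul_zero, add_zero] at hsum
    refine hsum.congr' (Eventually.of_forall fun β => ?_)
    simp only [hE]
    ring
  -- thresholds: the upper window bound and `8 b^θ ≤ b^{a_U}` must hold at `β' ≥ β/2`
  have haU : aU 4 = 1 / 30 := by norm_num [aU]
  have hgap : 0 < aU 4 - θ := by rw [haU]; linarith
  obtain ⟨βU, hβU⟩ := Filter.eventually_atTop.1 hU
  obtain ⟨β8, hβ8⟩ := Filter.eventually_atTop.1
    ((tendsto_rpow_atTop hgap).eventually_ge_atTop (8 : ℝ))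
  have hev : ∀ᶠ β : ℝ in atTop, max (max 2 (2 * βU)) (2 * β8) ≤ β ∧ E β ≤ β ^ (-κ₃) ∧
      (A₀ - β ^ (-κ₂) ≤ freeEnergyDensity 4 r.ρ β + 3 / 2 * (B.D : ℝ) * Real.log β) :=
    (eventually_ge_atTop _).and ((eventually_le_rpow_neg_of_tendsto hEt).and hLow')
  obtain ⟨β₀, hβ₀⟩ := Filter.eventually_atTop.1 hev
  refine ⟨3 * (B.D : ℝ), 1, κ₃, β₀, hκ₃0, fun β hβ ℓ hℓ1 hℓ2 u hu0 hu1 => ?_⟩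
  obtain ⟨hβmax, hEle, hLβ⟩ := hβ₀ β hβ
  have hβ2 : (2 : ℝ) ≤ β := le_trans (le_trans (le_max_left _ _) (le_max_left _ _)) hβmax
  have hβU2 : 2 * βU ≤ β := le_trans (le_trans (le_max_right _ _) (le_max_left _ _)) hβmax
  have hβ82 : 2 * β8 ≤ β := le_trans (le_max_right _ _) hβmax
  have hβ0 : 0 < β := by linarith
  have hβ1 : 1 ≤ β := by linarith
  have hlog : 0 ≤ Real.log β := Real.log_nonneg hβ1
  have hβθ : 0 < β ^ θ := Real.rpow_pos_of_pos hβ0 θ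
  have hx0 : 0 ≤ β ^ (-θ) := (Real.rpow_pos_of_pos hβ0 _).le
  have hs0 : (0 : ℝ) < (ℓ : ℝ) + 1 := by positivity
  have hs1 : 1 ≤ ℓ + 1 := by omega
  -- the second coupling `β' = β(1−u) ∈ [β/2, β]`
  have hβ'lo : β / 2 ≤ β * (1 - u) := by nlinarith
  have hβ'hi : β * (1 - u) ≤ β := by nlinarith
  generalize hβ' : β * (1 - u) = β' at hβ'lo hβ'hi ⊢
  have hβ'0 : 0 < β' := by linarith
  have hβ'1 : 1 ≤ β' := by linarith
  have hlog' : 0 ≤ Real.log β' := Real.log_nonneg hβ'1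
  -- the window at `β'`
  obtain ⟨hslo, hsU⟩ := window_aux hβ0 hβ'0 hβ'lo hβ'hi hθ (by linarith) (hβ8 β' (by linarith)) hℓ1 hℓ2
  have hTs := hβU β' (by linarith) (ℓ + 1) (by push_cast; exact hslo) (by push_cast; exact hsU)
  -- `T(B_s, β') = F(B_s, β') + ½(3 − 4/s + s⁻⁴) D log β'`
  have hT : B.T (ℓ + 1) β' = freeEnergyPerSite r.ρ β' (halfOpenBox 4 (ℓ + 1)) +
      3 / 2 * ((B.D : ℝ) * Real.log β') - 2 * (1 / ((ℓ : ℝ) + 1)) * ((B.D : ℝ) * Real.log β') +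
        1 / 2 * (1 / ((ℓ : ℝ) + 1) ^ 4) * ((B.D : ℝ) * Real.log β') := by
    rw [OneBoxBounds.T, OneBoxBounds.F, hBlog, ChatterjeeJointLimit.coef_eq (by norm_num) hs1,
      ChatterjeeFreeEnergy.freeEnergyPerSite_halfOpenBox_eq]
    push_cast
    ring
  have hq4 : 0 ≤ 1 / 2 * (1 / ((ℓ : ℝ) + 1) ^ 4) * ((B.D : ℝ) * Real.log β') := by positivity
  have hF'le : freeEnergyPerSite r.ρ β' (halfOpenBox 4 (ℓ + 1)) ≤
      A₀ + β' ^ (-κU) - 3 / 2 * ((B.D : ℝ) * Real.log β') +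
        2 * (1 / ((ℓ : ℝ) + 1)) * ((B.D : ℝ) * Real.log β') := by
    linarith [hT, hTs, hq4]
  -- lower bound at `β` (Lemma 17.3 + the torus lower rate)
  have hfle := ChatterjeeFreeEnergy.freeEnergyDensity_le (d := 4) r.ρ r.continuous hρN hβ0.le (ℓ + 1)
  push_cast at hfle
  have hF : freeEnergyPerSite r.ρ β (halfOpenBox 4 (ℓ + 1)) =
      Real.log (zdPartitionFunction r.ρ β (halfOpenBox 4 (ℓ + 1))).toReal / ((ℓ : ℝ) + 1) ^ 4 := by
    rw [ChatterjeeFreeEnergy.freeEnergyPerSite_halfOpenBox_eq]; push_cast; ring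
  have hfX : A₀ - β ^ (-κ₂) - 3 / 2 * ((B.D : ℝ) * Real.log β) ≤ freeEnergyDensity 4 r.ρ β := by linarith
  have hFlo := lower_aux (X := A₀ - β ^ (-κ₂) - 3 / 2 * ((B.D : ℝ) * Real.log β))
    (by linarith : (1 : ℝ) ≤ (ℓ : ℝ) + 1) hF hfle hfX
  -- `|X| ≤ |A₀| + 1 + (3/2) D log β`
  have hXabs : |A₀ - β ^ (-κ₂) - 3 / 2 * ((B.D : ℝ) * Real.log β)| ≤
      |A₀| + 1 + 3 / 2 * ((B.D : ℝ) * Real.log β) := by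
    have hk : β ^ (-κ₂) ≤ 1 := Real.rpow_le_one_of_one_le_of_nonpos hβ1 (by linarith)
    have hk0 : 0 ≤ β ^ (-κ₂) := (Real.rpow_pos_of_pos hβ0 _).le
    have hDl : 0 ≤ (B.D : ℝ) * Real.log β := by positivity
    rw [abs_le]
    constructor
    · have := neg_abs_le A₀; linarith
    · have := le_abs_self A₀; linarith
  -- `log β − log β' = −log(1 − u) ≤ 2u`, `log β' ≤ log β`
  have hlogdiff : Real.log β - Real.log β' ≤ 2 * u := by
    rw [← hβ']; exact log_sub_log_mul_one_sub_le hβ0 hu0 hu1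
  have hloglt : Real.log β' ≤ Real.log β := Real.log_le_log hβ'0 hβ'hi
  have hDl'le : (B.D : ℝ) * Real.log β' ≤ (B.D : ℝ) * Real.log β := mul_le_mul_of_nonneg_left hloglt hD
  have hDdiff : (B.D : ℝ) * Real.log β - (B.D : ℝ) * Real.log β' ≤ (B.D : ℝ) * (2 * u) := by
    rw [← mul_sub]; exact mul_le_mul_of_nonneg_left hlogdiff hD
  -- the small terms
  have hinv : 1 / ((ℓ : ℝ) + 1) ≤ β ^ (-θ) := by
    rw [Real.rpow_neg hβ0.le, ← one_div]
    exact one_div_le_one_div_of_le hβθ hℓ1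
  have hU' : β' ^ (-κU) ≤ c₀ * β ^ (-κU) := by
    have h1 : β' ^ (-κU) ≤ (β / 2) ^ (-κU) :=
      Real.rpow_le_rpow_of_nonpos (by positivity) hβ'lo (by linarith)
    have e : (β / 2) ^ (-κU) = c₀ * β ^ (-κU) := by
      rw [hc₀, div_eq_mul_one_div, Real.mul_rpow hβ0.le (by norm_num)]; ring
    linarith [e.le]
  rw [one_mul]
  exact crude_arith hF'le hFlo rfl hXabs (abs_nonneg _) hDdiff hDl'le (by positivity) (by positivity) hinv hx0
    hU' (rfl : E β = _) hEle

end Summit.QuantumFields.YangMills.Cruxes.SourcedPressureDecoupling.EntropicSeam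

end
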